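import Summits.QuantumFields.BalabanUV.T4Continuum.Support.NE7K1LinTorusResolventInverse

/-!
# NE7K1LinBoxResolventImages — row NE7 (node U5), candidate route HOM, path H1L, cell K1-lin(s): NEEDS-ESTIMATE #E1, R-E1 —
# THE BOUNDARY-CONDITION LAYER (o3), PART 1: B4's MULTIPLE-REFLECTION FORMULA (2.42) FOR THE TWO-CUTOFF LINE ON A NEUMANN BOX
# AND LEMMA 2.4 (2.35), FIRST QUANTITY, FOR `(T^Π(s) + a·Q_n^*Q_n)⁻¹Q_n^*` — constants in `(d, a₋, a₊)` ONLY

Lineage `b2b-balaban-t4-ne7-p2` (CRUX PROVER NE7 #2), generation 77; file 77.  PRICING-NE7 v39 §285 (f) (A-40-3): «FIRST (o3),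
the boundary-condition layers … (N-40-6): (α) DEFINITIONAL STEP FIRST … (β) EVENNESS … (γ) constants (k1) … (δ) the printed
defect census».

(α) THE DEFINITION (in the tree since generation 64, `NE7K1LinSchurLineU1.twoCutoffLine`): for ANY finite union `R′` of
`nL`-blocks of the fine lattice `ℤ^{d+1}` — a box, or B4's «Ω a union of big blocks» — the two-cutoff line with `R′`'s
NEUMANN conditions is `T^{R′}(s) + a·Q_n^*Q_n := twoCutoffLine hR′ n a s = (1 − s)·fineOpR n a 0 R + s·Schur(L^{−(d+1)}·Tᵀ·fineOpR (nL) a 0 R′·T)`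
on the `L`-block labels `R = R′.image (blk L)`: it is built from Bałaban's LOCAL fine operator `fineOpR` (B4 (1.3)–(1.6) at `A = 0`,
`B4Lower18`, Neumann conditions = bonds inside `R′` only) ONE LEVEL DOWN, then the hard Schur complement over the in-block
fluctuations (the KKT elimination of file 30) — N-40-6 (α)'s first alternative («through the fine local operator one level down
with Ω's conditions, then the fold»).  Nothing is defined by restricting a nonlocal effective operator.

(β) EVENNESS is met by WORKING ON THE LINE DIRECTLY (N-40-6 (β)'s second alternative): the method of images is the
OPERATOR-LEVEL fold of generation 72 — `NE7K1LinSchurFoldBox.twoCutoffLine_inv_fold_apply`: for the box `R′ = Π′ = boxDom (nL·M)`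
and its doubled torus `𝕋′ = boxDom (2nL·M)`, `G^Π(s)(y, y′) = Σ_{x ∈ 𝕋, fold x = y′} G^𝕋(s)(y, x)` for `a > 0`, `s ∈ [0,1]` —
whose input is the reflection invariance of the periodic fine operator (file 31 `foldLap_eq`, file 32 `torOpK_mul_unfoldM`),
not a symbol identity; no statement below quantifies over the class `SymbS`.

THIS FILE ([folklore] assembly of files 31 ∕ 34 ∕ 68 ∕ 76; no new estimate):
* §1 GEOMETRY OF THE IMAGES: for box labels `y₀, β ∈ boxDom M` and each of the `2^{d+1}` reflections `σ_ε β`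
  (`ρ_μ t = 2M_μ − 1 − t` where `ε_μ`), the doubled-torus sup-distance of `y₀ − σ_ε β` is AT LEAST `|y₀ − β|_∞`
  (`supNorm_le_torusSupNorm_image`; one coordinate: `abs_sub_le_circAbs_image`).
* §2 **`boxResolvent_eq_images`** — B4 (2.42) FOR THE LINE, verbatim shape: `G^Π(s)(y, y′) = Σ_{ε ∈ {0,1}^{d+1}} G^𝕋(s)(y, σ_ε y′)`
  (fine scale; file 34's fold + `fibre_eq_image_reflBox`); and **`boxResolventKernel_eq_images`** — THE AVERAGED RESOLVENT:
  for `a > 0`, `0 ≤ s ≤ 1`, `y = n·y₀ + τ ∈ Π`, `β ∈ boxDom M`,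
  `Σ_{y′ ∈ Π} G^Π(s)(y, y′)·1[blk_n y′ = β] = Σ_ε torusKernelS n (lineSymb L n s) a τ (2M) (y₀ − σ_ε β)`
  (blocks fold onto blocks, file 31 `blk_foldBox`; each coarse fibre term is file 76's docking
  `torLine_resolventKernel_eq_torusKernelS`).
* §3 **`boxResolventKernel_decay`** — LEMMA 2.4 (2.35), FIRST QUANTITY, FOR `(T^Π(s) + aQ_n^*Q_n)⁻¹Q_n^*` ON EVERY NEUMANN BOX:
  `‖Σ_{y′ ∈ Π} G^Π(s)(y, y′)·1[blk_n y′ = β]‖ ≤ 2^{d+1}·M_line(d,a₋)·periodConst(κ_line(d+1,a₋,a₊), d)·e^{−(κ_line∕(d+1))·|y₀ − β|_∞}`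
  for EVERY `s ∈ [0,1]`, `a ∈ [a₋,a₊]`, mesh `n ≥ 1`, `L ≥ 1`, box `M` (`M_μ ≥ 1`), `y ∈ Π`, `β ∈ boxDom M` — (γ): the constant
  and the rate are functions of `(d, a₋, a₊)` ALONE (file 68's `line_torusKernel_decay_torusMetric` on the doubled torus `2M`,
  whose `periodConst` is size-free, and §1); `s` enters only through `0 ≤ s ≤ 1` ((k2)); no THEOREM S outside the centred
  cell ((k3): inherited from file 76).  `boxResolventKernel_decay'` is the same display with `y₀ = blk_n y` read off `y`.
(δ) No printed constant is quoted: B4 proves (2.35) for `Δ^ξ`; the line is NOT in B4 (cell gap G-B4-04 ∕ D-b04.2 concern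
Cor. 2.3's layers and (1.12)'s distance factor, not (2.42); they are untouched here).

What (o3) still lacks after this file (HONEST): the SECOND quantity of (2.35) and the Hölder quotient (2.36) on boxes (the
torus-side DICTIONARY `n·(K(z+e_μ) − K(z)) = torusKernelDS`, `… = torusKernelHS` for the class, then the same fold — the fold acts
on the SOURCE variable only, so first-argument differences pass through it unchanged), and B4 Cor. 2.3-type layers for general
unions of big blocks beyond generation 70–71's random-walk entry decay (`NE7K1LinWalkLineRegion`, `NE7K1LinWalkLineDelta`).

HONEST FRAMING: [folklore]; finite identities plus one triangle inequality over `2^{d+1}` images; nothing of Bałaban's asserted;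
no `sorry`.  Census only (#E1's (o3), box layer, first quantity); NE7 NOT PRINTED ∕ NOT PROVED; spine 0∕9; FIXED FINITE T⁴,
rung (B)+1; NOT infinite volume, NOT mass gap, NOT Clay.  HONEST DEPENDENCY: continuum YM on T⁴ ⇐ BetaPertH ∧ nine spine
estimates (0/9 proved); BetaPertH ⇐ (D1) ∧ (D4) ∧ CAP+tail; G-an2-4 gates asym, D1 and NE2/3/4.
-/

noncomputable section

open Finset Matrix Complex

namespace Summit.QuantumFields.BalabanUV.T4Continuum.NE7K1LinBoxResolventImages

open Literature.MathematicalPhysics.QuantumFieldTheory.Balaban1983to89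
open Literature.MathematicalPhysics.QuantumFieldTheory.Balaban1983to89.B4Reflection242
open Literature.MathematicalPhysics.QuantumFieldTheory.Balaban1983to89.B4Lower18
open Literature.MathematicalPhysics.QuantumFieldTheory.Balaban1983to89.B4Green244 (finePt coarse offset coarse_finePt
  finePt_coarse_offset)
open Literature.MathematicalPhysics.QuantumFieldTheory.Balaban1983to89.B4ContourShift (supNorm)
open Literature.MathematicalPhysics.QuantumFieldTheory.Balaban1983to89.B4TorusKernel (periodConst)
open Literature.MathematicalPhysics.QuantumFieldTheory.Balaban1983to89.B4TorusKernel.MultiPeriod (torusSupNorm circAbs)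
open NE7K1LinFoldKernels NE7K1LinFoldMatrices NE7K1LinSchurFold NE7K1LinSchurFoldBox NE7K1LinSchurLineU1
open NE7K1LinStripClass NE7K1LinStripClassCauchy NE7K1LinStripClassLine NE7K1LinStripClassSums NE7K1LinStripClassLineDecay
open NE7K1LinTorusResolventInverse
open NE7K1LinTorusFloor (mem_image_of_mem_dbl mem_dbl_of_mem_image)

variable {d : ℕ}

/-! ### §1 Geometry of the images: the doubled-torus distance to an image is at least the box distance -/

section Geometry

/-- ONE COORDINATE: for `y, b ∈ [0, N)` and either image of `b` in the doubled period `2N` — `b` itself (`e = false`) or its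
reflection `2N − 1 − b` in the mirror at `N − 1∕2` (`e = true`) — the circular distance of `y − (image)` on `ℤ∕2N` is at least
`|y − b|`. [folklore] -/
theorem abs_sub_le_circAbs_image {N : ℕ} {y b : ℤ} (hy0 : 0 ≤ y) (hy1 : y < N) (hb0 : 0 ≤ b) (hb1 : b < N) (e : Bool) :
    |y - b| ≤ circAbs (2 * N) (y - refl1Fun N e (if e then 1 else 0) b) := by
  have hN2 : ((2 * N : ℕ) : ℤ) = 2 * (N : ℤ) := by push_cast; ring
  unfold circAbs
  rw [hN2]
  cases e with
  | false =>
    simp only [refl1Fun, Bool.false_eq_true, if_false, mul_zero, add_zero]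
    rcases le_or_gt b y with hle | hlt
    · have hmod : (y - b) % (2 * (N : ℤ)) = y - b := Int.emod_eq_of_lt (by omega) (by omega)
      rw [hmod, abs_sub_le_iff]
      exact ⟨le_min (by omega) (by omega), le_min (by omega) (by omega)⟩
    · have hmod : (y - b) % (2 * (N : ℤ)) = y - b + 2 * N := by
        have e : (y - b) % (2 * (N : ℤ)) = ((y - b + 2 * N) + (2 * (N : ℤ)) * (-1)) % (2 * (N : ℤ)) := by
          congr 1; ring
        rw [e, Int.add_mul_emod_self_left]
        exact Int.emod_eq_of_lt (by omega) (by omega)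
      rw [hmod, abs_sub_le_iff]
      exact ⟨le_min (by omega) (by omega), le_min (by omega) (by omega)⟩
  | true =>
    simp only [refl1Fun, if_true, mul_one]
    have hmod : (y - (2 * (N : ℤ) - 1 - b)) % (2 * (N : ℤ)) = y + b + 1 := by
      rw [show (y - (2 * (N : ℤ) - 1 - b) : ℤ) = (y + b + 1) + (2 * (N : ℤ)) * (-1) by ring, Int.add_mul_emod_self_left]
      exact Int.emod_eq_of_lt (by omega) (by omega)
    rw [hmod, abs_sub_le_iff]
    exact ⟨le_min (by omega) (by omega), le_min (by omega) (by omega)⟩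

/-- **THE DOUBLED-TORUS DISTANCE TO EVERY IMAGE DOMINATES THE BOX DISTANCE**: for `y₀, β ∈ boxDom M` and `ε ∈ {0,1}^{d+1}`,
`|y₀ − β|_∞ ≤ dist_{𝕋(2M)}(y₀ − σ_ε β)` where `σ_ε = reflBox M ε [ε]` reflects the coordinates `μ` with `ε_μ` in the mirror at
`M_μ − 1∕2`. [folklore] -/
theorem supNorm_le_torusSupNorm_image {M : Fin (d + 1) → ℕ} {y₀ β : Fin (d + 1) → ℤ} (hy₀ : y₀ ∈ boxDom M)
    (hβ : β ∈ boxDom M) (ε : Fin (d + 1) → Bool) :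
    supNorm (y₀ - β) ≤ torusSupNorm (dbl M) (y₀ - reflBox M ε (fun i => if ε i then 1 else 0) β) := by
  rw [mem_boxDom] at hy₀ hβ
  unfold supNorm torusSupNorm
  refine Finset.sup'_mono_fun fun i _ => ?_
  have h := abs_sub_le_circAbs_image (hy₀ i).1 (hy₀ i).2 (hβ i).1 (hβ i).2 (ε i)
  simp only [Pi.sub_apply, reflBox_apply, dbl_apply]
  exact_mod_cast h

end Geometry

/-! ### §2 The method of images (2.42) for the two-cutoff line and for its averaged resolvent -/

section Images

variable {n L : ℕ} [NeZero n] [NeZero L] {M : Fin (d + 1) → ℕ}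

omit [NeZero n] in
/-- a box label is a point of the box `Π = boxDom (n·M)`. [folklore] -/
theorem boxLabel_mem (y : ↥((boxDom fun i => n * L * M i).image (blk L))) : y.1 ∈ boxDom (fun i => n * M i) := by
  rw [← image_fineBox (NeZero.one_le : 1 ≤ L) n M]; exact y.2

omit [NeZero n] in
/-- a box label is its own torus representative and folds to itself. [folklore] -/
theorem foldBox_boxLabel (hn : 1 ≤ n) (hM : ∀ i, 1 ≤ M i) (y : ↥((boxDom fun i => n * L * M i).image (blk L))) :
    foldBox (fun i => n * M i) y.1 = y.1 := by
  have hy := boxLabel_mem y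
  rw [mem_boxDom] at hy
  funext i
  exact fold1_of_mem (mul_pos_side hn hM i) (hy i).1 (hy i).2

omit [NeZero n] in
/-- the `n`-block label of a torus label lies in the coarse doubled torus `boxDom (2M)`. [folklore] -/
theorem blk_torLabel_mem_dbl (hn : 1 ≤ n) (x : ↥((boxDom (dbl fun i => n * L * M i)).image (blk L))) :
    blk n x.1 ∈ boxDom (dbl M) := by
  have hx := mem_dbl_of_mem_image x.2
  have he : boxDom (dbl fun i => n * M i) = boxDom (fun i => n * dbl M i) := by
    congr 1; funext i; simp only [dbl_apply]; ring
  rw [he] at hx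
  exact blk_mem_boxDom hn hx

omit [NeZero n] in
/-- the complexified torus line's inverse has the entries of the real inverse (`a > 0`, `0 ≤ s ≤ 1`). [folklore] -/
theorem torLine_map_inv_apply (hn : 1 ≤ n) (hM : ∀ i, 1 ≤ M i) {a : ℝ} (ha : 0 < a) {s : ℝ} (hs0 : 0 ≤ s) (hs1 : s ≤ 1)
    (x x' : ↥((boxDom (dbl fun i => n * L * M i)).image (blk L))) :
    ((torLine (isBlockUnion_fine (fineTor_isBlockUnion hn (NeZero.one_le : 1 ≤ L) M)) n a (fun i => n * L * M i)
        (fun i => n * M i) s).map Complex.ofReal)⁻¹ x x' =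
      (((torLine (isBlockUnion_fine (fineTor_isBlockUnion hn (NeZero.one_le : 1 ≤ L) M)) n a (fun i => n * L * M i)
        (fun i => n * M i) s)⁻¹ x x' : ℝ) : ℂ) := by
  set T := torLine (isBlockUnion_fine (fineTor_isBlockUnion hn (NeZero.one_le : 1 ≤ L) M)) n a (fun i => n * L * M i)
    (fun i => n * M i) s with hT
  have hdet : IsUnit T.det := isUnit_det_torLine hn ha hM hs0 hs1
  have hinv : (T.map Complex.ofReal)⁻¹ = T⁻¹.map Complex.ofReal := by
    refine Matrix.inv_eq_right_inv ?_
    have e : (Complex.ofReal : ℝ → ℂ) = ⇑Complex.ofRealHom := rfl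
    rw [e, ← Matrix.map_mul, Matrix.mul_nonsing_inv T hdet, Matrix.map_one _ (map_zero _) (map_one _)]
  rw [hinv, Matrix.map_apply]

omit [NeZero n] in
/-- **B4 (2.42) FOR THE TWO-CUTOFF LINE, VERBATIM SHAPE** (fine scale): for `a > 0`, `0 ≤ s ≤ 1`, box labels `y, y′ ∈ Π`,
`G^Π(s)(y, y′) = Σ_{ε ∈ {0,1}^{d+1}} G^𝕋(s)(y, σ_ε y′)` — the Neumann-box resolvent of the line is the sum of the doubled-torus
resolvent over the `2^{d+1}` reflections of the source (file 34's fold, source fibre = `fibre_eq_image_reflBox`). [folklore] -/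
theorem boxResolvent_eq_images (hn : 1 ≤ n) (hM : ∀ i, 1 ≤ M i) {a : ℝ} (ha : 0 < a) {s : ℝ} (hs0 : 0 ≤ s) (hs1 : s ≤ 1)
    (y y' : ↥((boxDom fun i => n * L * M i).image (blk L))) :
    (twoCutoffLine (isBlockUnion_fine (fineBox_isBlockUnion hn (NeZero.one_le : 1 ≤ L) M)) n a s)⁻¹ y y' =
      ∑ ε : Fin (d + 1) → Bool,
        (torLine (isBlockUnion_fine (fineTor_isBlockUnion hn (NeZero.one_le : 1 ≤ L) M)) n a (fun i => n * L * M i)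
          (fun i => n * M i) s)⁻¹ ⟨y.1, mem_image_tor_of_mem y.2⟩
          ⟨reflBox (fun i => n * M i) ε (fun i => if ε i then 1 else 0) y'.1,
            mem_image_of_mem_dbl (reflBox_mem_dbl ε (boxLabel_mem y'))⟩ := by
  classical
  obtain ⟨x₀, hx₀v⟩ : ∃ x₀ : ↥((boxDom (dbl fun i => n * L * M i)).image (blk L)), x₀.1 = y.1 :=
    ⟨⟨y.1, mem_image_tor_of_mem y.2⟩, rfl⟩
  have hyf : (⟨foldBox (fun i => n * M i) x₀.1, foldBox_mem_image hn hM x₀.1⟩ :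
      ↥((boxDom fun i => n * L * M i).image (blk L))) = y :=
    Subtype.ext (by simp only [hx₀v]; exact foldBox_boxLabel hn hM y)
  have h := twoCutoffLine_inv_fold_apply hn ha hM hs0 hs1 x₀ y'
  rw [hyf] at h
  rw [h]
  have hy' : y'.1 ∈ boxDom (fun i => n * M i) := boxLabel_mem y'
  -- the fibre over `y′` is the image of the reflections
  have hfib : (Finset.univ.filter fun x : ↥((boxDom (dbl fun i => n * L * M i)).image (blk L)) =>
      foldBox (fun i => n * M i) x.1 = y'.1) =
      Finset.univ.image (fun ε : Fin (d + 1) → Bool =>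
        (⟨reflBox (fun i => n * M i) ε (fun i => if ε i then 1 else 0) y'.1,
          mem_image_of_mem_dbl (reflBox_mem_dbl ε hy')⟩ :
          ↥((boxDom (dbl fun i => n * L * M i)).image (blk L)))) := by
    ext x
    simp only [Finset.mem_filter, Finset.mem_univ, true_and, Finset.mem_image]
    have hset := fibre_eq_image_reflBox (mul_pos_side hn hM) hy'
    constructor
    · intro hx
      have hxm : x.1 ∈ (boxDom (dbl fun i => n * M i)).filter (fun z => foldBox (fun i => n * M i) z = y'.1) := by
        exact Finset.mem_filter.2 ⟨mem_dbl_of_mem_image x.2, hx⟩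
      rw [hset, Finset.mem_image] at hxm
      obtain ⟨ε, -, hε⟩ := hxm
      exact ⟨ε, Subtype.ext hε⟩
    · rintro ⟨ε, hε⟩
      rw [← hε]
      have hm : reflBox (fun i => n * M i) ε (fun i => if ε i then 1 else 0) y'.1 ∈
          (boxDom (dbl fun i => n * M i)).filter (fun z => foldBox (fun i => n * M i) z = y'.1) := by
        rw [hset]; exact Finset.mem_image.2 ⟨ε, Finset.mem_univ _, rfl⟩
      exact (Finset.mem_filter.1 hm).2
  rw [hfib, Finset.sum_image]
  · have hx₀y : x₀ = ⟨y.1, mem_image_tor_of_mem y.2⟩ := Subtype.ext hx₀v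
    rw [hx₀y]
  · intro ε₁ _ ε₂ _ h
    exact reflBox_eps_injective (mul_pos_side hn hM) y'.1 (Subtype.ext_iff.1 h)

/-- **THE AVERAGED RESOLVENT BY IMAGES**: for `a > 0`, `0 ≤ s ≤ 1`, a box label `y = n·y₀ + τ ∈ Π` and a coarse box label
`β ∈ boxDom M`,
`Σ_{y′ ∈ Π} G^Π(s)(y, y′)·1[blk_n y′ = β] = Σ_{ε ∈ {0,1}^{d+1}} torusKernelS n (lineSymb L n s) a τ (2M) (y₀ − σ_ε β)`
— the kernel of `(T^Π(s) + aQ_n^*Q_n)⁻¹Q_n^*` on the Neumann box is the sum over the `2^{d+1}` coarse images of file 68's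
doubled-torus kernel (file 34's fold; blocks fold onto blocks, file 31; file 76's docking on each coarse fibre). [folklore] -/
theorem boxResolventKernel_eq_images (hn : 1 ≤ n) (hM : ∀ i, 1 ≤ M i) {a : ℝ} (ha : 0 < a) {s : ℝ} (hs0 : 0 ≤ s)
    (hs1 : s ≤ 1) (y : ↥((boxDom fun i => n * L * M i).image (blk L))) {y₀ : Fin (d + 1) → ℤ}
    {τ : Fin (d + 1) → Fin n} (hy : y.1 = finePt n y₀ τ) {β : Fin (d + 1) → ℤ} (hβ : β ∈ boxDom M) :
    ∑ y' : ↥((boxDom fun i => n * L * M i).image (blk L)),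
        (((twoCutoffLine (isBlockUnion_fine (fineBox_isBlockUnion hn (NeZero.one_le : 1 ≤ L) M)) n a s)⁻¹ y y' : ℝ) : ℂ) *
          (if blk n y'.1 = β then (1 : ℂ) else 0) =
      ∑ ε : Fin (d + 1) → Bool,
        torusKernelS n (lineSymb L n s) a τ (dbl M) (y₀ - reflBox M ε (fun i => if ε i then 1 else 0) β) := by
  classical
  obtain ⟨x₀, hx₀v⟩ : ∃ x₀ : ↥((boxDom (dbl fun i => n * L * M i)).image (blk L)), x₀.1 = y.1 :=
    ⟨⟨y.1, mem_image_tor_of_mem y.2⟩, rfl⟩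
  have hx₀ : x₀.1 = finePt n y₀ τ := hx₀v.trans hy
  have hyf : (⟨foldBox (fun i => n * M i) x₀.1, foldBox_mem_image hn hM x₀.1⟩ :
      ↥((boxDom fun i => n * L * M i).image (blk L))) = y :=
    Subtype.ext (by simp only [hx₀v]; exact foldBox_boxLabel hn hM y)
  set GP := (twoCutoffLine (isBlockUnion_fine (fineBox_isBlockUnion hn (NeZero.one_le : 1 ≤ L) M)) n a s)⁻¹ with hGP
  set GT := (torLine (isBlockUnion_fine (fineTor_isBlockUnion hn (NeZero.one_le : 1 ≤ L) M)) n a (fun i => n * L * M i)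
    (fun i => n * M i) s)⁻¹ with hGT
  -- the fold map on labels
  set fT : ↥((boxDom (dbl fun i => n * L * M i)).image (blk L)) → ↥((boxDom fun i => n * L * M i).image (blk L)) :=
    fun x => ⟨foldBox (fun i => n * M i) x.1, foldBox_mem_image hn hM x.1⟩ with hfT
  -- step 1: fold every entry of the row `y`
  have hentry : ∀ y' : ↥((boxDom fun i => n * L * M i).image (blk L)),
      GP y y' = ∑ x ∈ Finset.univ.filter (fun x => fT x = y'), GT x₀ x := by
    intro y'
    have h := twoCutoffLine_inv_fold_apply hn ha hM hs0 hs1 x₀ y'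
    rw [hyf] at h
    rw [hGP, h]
    refine Finset.sum_congr (Finset.filter_congr fun x _ => ?_) fun _ _ => rfl
    rw [hfT, Subtype.ext_iff]
  -- step 2: re-sum over the torus labels (every torus label folds to exactly one box label)
  have hstep2 : ∑ y' : ↥((boxDom fun i => n * L * M i).image (blk L)), ((GP y y' : ℝ) : ℂ) *
        (if blk n y'.1 = β then (1 : ℂ) else 0) =
      ∑ x : ↥((boxDom (dbl fun i => n * L * M i)).image (blk L)), ((GT x₀ x : ℝ) : ℂ) *
        (if blk n (foldBox (fun i => n * M i) x.1) = β then (1 : ℂ) else 0) := by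
    have hmaps : ∀ x ∈ (Finset.univ : Finset ↥((boxDom (dbl fun i => n * L * M i)).image (blk L))),
        fT x ∈ (Finset.univ : Finset ↥((boxDom fun i => n * L * M i).image (blk L))) := fun _ _ => Finset.mem_univ _
    rw [← Finset.sum_fiberwise_of_maps_to hmaps]
    refine Finset.sum_congr rfl fun y' _ => ?_
    rw [hentry y']
    push_cast
    rw [Finset.sum_mul]
    refine Finset.sum_congr rfl fun x hx => ?_
    have hx' : fT x = y' := (Finset.mem_filter.1 hx).2
    rw [← hx']
  rw [hstep2]
  -- step 3: blocks fold onto blocks, and the folded indicator is a sum over the coarse fibre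
  have hind : ∀ x : ↥((boxDom (dbl fun i => n * L * M i)).image (blk L)),
      (if blk n (foldBox (fun i => n * M i) x.1) = β then (1 : ℂ) else 0) =
        ∑ β' ∈ (boxDom (dbl M)).filter (fun β' => foldBox M β' = β), (if blk n x.1 = β' then (1 : ℂ) else 0) := by
    intro x
    rw [blk_foldBox hn hM x.1, Finset.sum_ite_eq]
    have hmem : blk n x.1 ∈ boxDom (dbl M) := blk_torLabel_mem_dbl hn x
    by_cases h : foldBox M (blk n x.1) = β
    · rw [if_pos h, if_pos (Finset.mem_filter.2 ⟨hmem, h⟩)]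
    · rw [if_neg h, if_neg]
      exact fun h' => h (Finset.mem_filter.1 h').2
  simp_rw [hind, Finset.mul_sum]
  rw [Finset.sum_comm]
  -- step 4: each coarse fibre term is file 76's docking
  have hdock : ∀ β' ∈ (boxDom (dbl M)).filter (fun β' => foldBox M β' = β),
      ∑ x : ↥((boxDom (dbl fun i => n * L * M i)).image (blk L)), ((GT x₀ x : ℝ) : ℂ) *
          (if blk n x.1 = β' then (1 : ℂ) else 0) =
        torusKernelS n (lineSymb L n s) a τ (dbl M) (y₀ - β') := by
    intro β' hβ'
    have hβ'm : β' ∈ boxDom (dbl M) := (Finset.mem_filter.1 hβ').1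
    rw [← torLine_resolventKernel_eq_torusKernelS hn hM ha hs0 hs1 x₀ hx₀ hβ'm]
    refine Finset.sum_congr rfl fun x _ => ?_
    rw [torLine_map_inv_apply hn hM ha hs0 hs1]
  rw [Finset.sum_congr rfl hdock]
  -- step 5: the coarse fibre over `β` is the set of its `2^{d+1}` reflections
  rw [fibre_eq_image_reflBox hM hβ, Finset.sum_image fun ε₁ _ ε₂ _ h => reflBox_eps_injective hM β h]

end Images

/-! ### §3 Lemma 2.4 (2.35), first quantity, for the line's averaged resolvent on every Neumann box -/

section Decay

variable {n L : ℕ} [NeZero n] [NeZero L] {M : Fin (d + 1) → ℕ}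

/-- **LEMMA 2.4 (2.35), FIRST QUANTITY, FOR `(T^Π(s) + aQ_n^*Q_n)⁻¹Q_n^*` ON A NEUMANN BOX** — for `a ∈ [a₋, a₊]` (`a₋ > 0`),
`0 ≤ s ≤ 1`, every mesh `n ≥ 1`, refinement `L ≥ 1`, box `M` (`M_μ ≥ 1`), every box label `y = n·y₀ + τ ∈ Π` and coarse label
`β ∈ boxDom M`:
`‖Σ_{y′ ∈ Π} G^Π(s)(y, y′)·1[blk_n y′ = β]‖ ≤ 2^{d+1}·M_line(d,a₋)·periodConst(κ_line(d+1,a₋,a₊), d)·e^{−(κ_line(d+1,a₋,a₊)∕(d+1))·|y₀ − β|_∞}`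
— constant and rate in `(d, a₋, a₊)` only. [folklore] -/
theorem boxResolventKernel_decay (hn : 1 ≤ n) (hM : ∀ i, 1 ≤ M i) {aminus aplus a : ℝ} (ha : 0 < aminus)
    (ha1 : aminus ≤ a) (ha2 : a ≤ aplus) {s : ℝ} (hs0 : 0 ≤ s) (hs1 : s ≤ 1)
    (y : ↥((boxDom fun i => n * L * M i).image (blk L))) {y₀ : Fin (d + 1) → ℤ} {τ : Fin (d + 1) → Fin n}
    (hy : y.1 = finePt n y₀ τ) {β : Fin (d + 1) → ℤ} (hβ : β ∈ boxDom M) :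
    ‖∑ y' : ↥((boxDom fun i => n * L * M i).image (blk L)),
        (((twoCutoffLine (isBlockUnion_fine (fineBox_isBlockUnion hn (NeZero.one_le : 1 ≤ L) M)) n a s)⁻¹ y y' : ℝ) : ℂ) *
          (if blk n y'.1 = β then (1 : ℂ) else 0)‖ ≤
      2 ^ (d + 1) * (Mline d aminus * periodConst (kappaLine (d + 1) aminus aplus) d) *
        Real.exp (-(kappaLine (d + 1) aminus aplus / (d + 1) * supNorm (y₀ - β))) := by
  have ha0 : 0 < a := lt_of_lt_of_le ha ha1
  rw [boxResolventKernel_eq_images hn hM ha0 hs0 hs1 y hy hβ]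
  have hy₀ : y₀ ∈ boxDom M := by
    have h1 : y.1 ∈ boxDom (fun i => n * M i) := boxLabel_mem y
    have h2 : blk n y.1 = y₀ := by rw [hy]; exact coarse_finePt n y₀ τ
    rw [← h2]; exact blk_mem_boxDom hn h1
  set C := Mline d aminus * periodConst (kappaLine (d + 1) aminus aplus) d with hC
  set κ' := kappaLine (d + 1) aminus aplus / (d + 1) with hκ'
  have hκ'0 : 0 ≤ κ' := (div_pos (kappaLine_pos (d + 1) aplus ha) (by positivity)).le
  have hterm : ∀ ε : Fin (d + 1) → Bool,
      ‖torusKernelS n (lineSymb L n s) a τ (dbl M) (y₀ - reflBox M ε (fun i => if ε i then 1 else 0) β)‖ ≤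
        C * Real.exp (-(κ' * supNorm (y₀ - β))) := by
    intro ε
    have h := line_torusKernel_decay_torusMetric L n hs0 hs1 ha ha1 ha2 τ (dbl_pos hM)
      (y₀ - reflBox M ε (fun i => if ε i then 1 else 0) β)
    refine h.trans ?_
    have hE : 0 < Real.exp (-(kappaLine (d + 1) aminus aplus / (d + 1) *
        torusSupNorm (dbl M) (y₀ - reflBox M ε (fun i => if ε i then 1 else 0) β))) := Real.exp_pos _
    have hC0 : 0 ≤ C := by
      by_contra hneg
      push Not at hneg
      have := mul_neg_of_neg_of_pos hneg hE
      linarith [norm_nonneg (torusKernelS n (lineSymb L n s) a τ (dbl M)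
        (y₀ - reflBox M ε (fun i => if ε i then 1 else 0) β))]
    refine mul_le_mul_of_nonneg_left (Real.exp_le_exp.2 ?_) hC0
    have hg := supNorm_le_torusSupNorm_image hy₀ hβ ε
    rw [← hκ']
    nlinarith
  calc ‖∑ ε : Fin (d + 1) → Bool,
          torusKernelS n (lineSymb L n s) a τ (dbl M) (y₀ - reflBox M ε (fun i => if ε i then 1 else 0) β)‖
        ≤ ∑ ε : Fin (d + 1) → Bool,
          ‖torusKernelS n (lineSymb L n s) a τ (dbl M) (y₀ - reflBox M ε (fun i => if ε i then 1 else 0) β)‖ :=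
        norm_sum_le _ _
    _ ≤ ∑ _ε : Fin (d + 1) → Bool, C * Real.exp (-(κ' * supNorm (y₀ - β))) := Finset.sum_le_sum fun ε _ => hterm ε
    _ = 2 ^ (d + 1) * C * Real.exp (-(κ' * supNorm (y₀ - β))) := by
        rw [Finset.sum_const, Finset.card_univ, Fintype.card_fun, Fintype.card_bool, Fintype.card_fin, nsmul_eq_mul]
        push_cast
        ring

/-- the same display with the block label and offset READ OFF the box point: for every `y ∈ Π` and `β ∈ boxDom M`,
`‖Σ_{y′ ∈ Π} G^Π(s)(y, y′)·1[blk_n y′ = β]‖ ≤ 2^{d+1}·M_line·periodConst·e^{−(κ_line∕(d+1))·|blk_n y − β|_∞}` — B4's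
«`|(G_j(□)Q_j^*)(x, y)| ≤ c₀e^{−δ₀|x−y|}` for all `x ∈ □`, `y ∈ □^{(j)}`» for the line, constants in `(d, a₋, a₊)` only. [folklore] -/
theorem boxResolventKernel_decay' (hn : 1 ≤ n) (hM : ∀ i, 1 ≤ M i) {aminus aplus a : ℝ} (ha : 0 < aminus)
    (ha1 : aminus ≤ a) (ha2 : a ≤ aplus) {s : ℝ} (hs0 : 0 ≤ s) (hs1 : s ≤ 1)
    (y : ↥((boxDom fun i => n * L * M i).image (blk L))) {β : Fin (d + 1) → ℤ} (hβ : β ∈ boxDom M) :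
    ‖∑ y' : ↥((boxDom fun i => n * L * M i).image (blk L)),
        (((twoCutoffLine (isBlockUnion_fine (fineBox_isBlockUnion hn (NeZero.one_le : 1 ≤ L) M)) n a s)⁻¹ y y' : ℝ) : ℂ) *
          (if blk n y'.1 = β then (1 : ℂ) else 0)‖ ≤
      2 ^ (d + 1) * (Mline d aminus * periodConst (kappaLine (d + 1) aminus aplus) d) *
        Real.exp (-(kappaLine (d + 1) aminus aplus / (d + 1) * supNorm (blk n y.1 - β))) := by
  have hy : y.1 = finePt n (coarse n y.1) (offset n y.1) := (finePt_coarse_offset n y.1).symm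
  exact boxResolventKernel_decay hn hM ha ha1 ha2 hs0 hs1 y hy hβ

end Decay

end Summit.QuantumFields.BalabanUV.T4Continuum.NE7K1LinBoxResolventImages

end
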